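import Summits.Ventures.YMGap.RobustBall.RowsSMassive
import Summits.Ventures.YMGap.RobustBall.RowsSN
import HarnessLib

/-!
# Venture statement — YMGap (cell `pub-ymgap`) — CONJUNCT BODIES T32, T33 (track Y2 ROBUST-BALL, TIER 2: every DLR state of
# every member of the weighted, infinite-range `ℤ⁴` ball is MASSIVE; PLAN R215 (iii))

HONEST FRAMING. WHAT THIS IS: bodies `Tk_… : Prop` + witnesses `Tk_…_holds` of two conjuncts of the venture statement (index of
record: `Summits/Ventures/YMGap/Statement.lean`, frozen at v1.6 for length, continued in `Summits/Ventures/YMGap/StatementIndex.lean`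
by PLAN R215). Both are kernel-checked, carry NO hypothesis, and are the TIER-2 MASSIVE-STATE twins of T22 (ii) / T27 and T24 (i):
lattice `SU(N)` Yang–Mills at STRONG COUPLING on `ℤ⁴` with the Wilson action replaced by any member `W` of the tier-2 ball
`RobustBall.MemBallZdS a Λ t` (summable, possibly infinite-range continuous link potentials; oscillation load `≤ a`; diagonal-free
cross-Lipschitz load weighted by `e^{t‖e−y‖_∞}` `≤ Λ`; `t > 0` the clustering rate). Texts typed by seat ds-3 (g9) against the tree;
DOOR-LEVEL statements (the hypothesis is the row condition of the one-link pair plus loads, not the currency `MassGapOnBallZdS`).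
* **T32** `SU(2)`, `d = 4`: for every `β_W, a, Λ` and `t > 0` with `6|β_W| e^{a} e^{t} + e^{a/2} √(2/3) Λ < 1`, every member has DLR
  states and EVERY one of them is MASSIVE (`IsMassiveState`) with exponentially decaying plaquette–plaquette correlation function
  (cells of record `(β_W, ε, e^{t}) = (1/16, 0.143, 2)`, `(1/16, 0.186, 3/2)` — T27 (ii)).
* **T33** every `N ≥ 2`, `d = 4`, 't Hooft `1/64`: (i) the all-`N` tier-2 clustering row `MassGapOnBallZdS 4 N (1/64) (1/20) (1/10) (log(6/5))`
  (seat rb-p1; loads `(1/20, 1/10)`, rate `log(6/5)`); (ii) every member of that ball has DLR states, all MASSIVE with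
  plaquette–plaquette decay (seat ds-3).
Every radius is where a DOOR closes (an artefact of the bound), not the extent of a phase. WHAT THIS IS NOT: no continuum statement,
no rate beyond the displayed ones / `∃ m > 0`, no spectral gap, nothing about perturbations merely small in sup-norm, no claim on the
Yang–Mills Millennium problem.
-/

noncomputable section

namespace Summit.Ventures.YMGap

open Literature.Probability.LatticeModels (HasExponentialDecay Potential)
open Literature.MathematicalPhysics.QuantumLattice (fundamentalRep plaquetteCorrFn ZdEdge)
open Literature.Barriers.QuantumFields (IsMassiveState)
open Summit.Ventures.YMGap.RobustBall

/-- **T32 — track Y2, TIER 2: `SU(2)`, `d = 4`, EVERY DLR STATE OF EVERY MEMBER OF THE WEIGHTED INFINITE-RANGE `ℤ⁴` BALL IS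
MASSIVE, HYPOTHESIS-FREE** (Wilson `β_W`; tree coupling `β_W/2` written as `2·(β_W/4)`): for every weight `t > 0` and loads `(a, Λ)`
with `6|β_W| e^{a} e^{t} + e^{a/2} √(2/3) Λ < 1` (the door of T27 (i)), every member `W` of `MemBallZdS a Λ t` added to the `SU(2)`
Wilson action at `β_W` has DLR states, and EVERY one of them is a MASSIVE STATE (`IsMassiveState`: one rate for all truncated
correlations of bounded measurable local observables) whose plaquette–plaquette correlation function decays exponentially
(`RobustBall.su2_massive_onBallZdS_dim4`, seat ds-3; cells of record `RobustBall.su2_massiveS_rowBS2_1_16` — `(β_W, ε, e^{t}) =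
(1/16, 0.143, 2)` — and `su2_massiveS_rowS32_1_16` — `(1/16, 0.186, 3/2)`). The tier-2 twin of T22 (ii). -/
def T32_SU2TierTwoBallMassive : Prop :=
  ∀ βW a Λ t : ℝ, 0 < t → 6 * |βW| * (Real.exp a * Real.exp t) + Real.exp (a / 2) * Real.sqrt (2 / 3) * Λ < 1 →
    ∀ W : Potential (ZdEdge 4) (Matrix.specialUnitaryGroup (Fin 2) ℂ), MemBallZdS a Λ t W →
      (perturbedGibbsMeasuresS (d := 4) (fundamentalRep (Fin 2)) (((2 : ℕ) : ℝ) * (βW / 4)) W).Nonempty ∧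
        ∀ μ ∈ perturbedGibbsMeasuresS (d := 4) (fundamentalRep (Fin 2)) (((2 : ℕ) : ℝ) * (βW / 4)) W,
          IsMassiveState μ ∧ HasExponentialDecay (plaquetteCorrFn (fundamentalRep (Fin 2)) μ)

/-- T32 holds (`RobustBall.su2_massive_onBallZdS_dim4`). -/
theorem T32_SU2TierTwoBallMassive_holds : T32_SU2TierTwoBallMassive :=
  fun _ _ _ _ ht hρ _ hW => su2_massive_onBallZdS_dim4 ht hρ hW

/-- **T33 — track Y2, TIER 2: EVERY `N ≥ 2`, `d = 4`, 't Hooft coupling `1/64` (tree coupling `N/64`), HYPOTHESIS-FREE**: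
(i) the all-`N` tier-2 clustering row — every member of the weighted ball `MemBallZdS (1/20) (1/10) (log(6/5))` (oscillation load
`≤ 1/20`, weighted cross load `≤ 1/10`, weight/rate `log(6/5)`) added to `N·(1/64)·S_W` has exactly one DLR state, exponentially
clustering: `MassGapOnBallZdS 4 N (1/64) (1/20) (1/10) (log(6/5))` (`RobustBall.suN_rowS_1_64`, seat rb-p1, Bakry–Émery pair);
(ii) every member of that ball has DLR states and EVERY one of them is MASSIVE with exponentially decaying plaquette–plaquette
correlation function (`RobustBall.suN_massiveS_rowS_1_64`, seat ds-3). The tier-2 twin of T24 (i). -/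
def T33_SUNTierTwoBallMassive : Prop :=
  (∀ N : ℕ, 2 ≤ N → MassGapOnBallZdS 4 N (1 / 64) (1 / 20) (1 / 10) (Real.log (6 / 5))) ∧
    (∀ N : ℕ, 2 ≤ N → ∀ W : Potential (ZdEdge 4) (Matrix.specialUnitaryGroup (Fin N) ℂ),
      MemBallZdS (1 / 20) (1 / 10) (Real.log (6 / 5)) W →
        (perturbedGibbsMeasuresS (d := 4) (fundamentalRep (Fin N)) ((N : ℝ) * (1 / 64)) W).Nonempty ∧
          ∀ μ ∈ perturbedGibbsMeasuresS (d := 4) (fundamentalRep (Fin N)) ((N : ℝ) * (1 / 64)) W,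
            IsMassiveState μ ∧ HasExponentialDecay (plaquetteCorrFn (fundamentalRep (Fin N)) μ))

/-- T33 holds (`RobustBall.suN_rowS_1_64`, `RobustBall.suN_massiveS_rowS_1_64`). -/
theorem T33_SUNTierTwoBallMassive_holds : T33_SUNTierTwoBallMassive :=
  ⟨fun _ hN => suN_rowS_1_64 hN, fun _ hN _ hW => suN_massiveS_rowS_1_64 hN hW⟩

end Summit.Ventures.YMGap

end
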